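import Mathlib
import Summits.Ventures.LatticeQCDFlow.TrivializingMaps.PlaquetteHaarMoments
import Summits.Ventures.LatticeQCDFlow.TrivializingMaps.HaarTraceMomentsSUn
import Summits.Ventures.LatticeQCDFlow.TrivializingMaps.WilsonSU2FisherZeroRadius
import Literature.MathematicalPhysics.QuantumFieldTheory.TorusPlaquetteNeighbours
import Literature.MathematicalPhysics.QuantumFieldTheory.ConstructiveQFTWave0Proofs
import Literature.MathematicalPhysics.QuantumFieldTheory.LatticeGaugeProofs
import HarnessLib

/-!
# THEOREM V — a variance floor for the plaquette witness, uniform in the volume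

HONEST FRAMING: exact (Metropolis-corrected) sampling algorithms for lattice gauge theory; figures of
merit are autocorrelation/cost numbers at stated couplings and volumes; no continuum-physics claim.

THEOREMS W/W′ (`WitnessColumnRP`, `WitnessColumnLinkRP`, `WitnessColumnPlaquette`) turn the INPUT
column of the footprint law into two measured numbers, `v_p = Var_β(Re tr ρ(U_p))` and a covariance
`c`, both carried as hypotheses `0 < v_p`, `0 < c`. This file DISCHARGES the first one, for every real
`β`, every `L ≥ 2`, every `d`, by a one-link Haar resampling (domination) argument:
* `abs_wilsonAction_mulSingle_sub_le` — replacing one link `U_e ↦ h U_e` moves the Wilson action by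
  at most `2 N · #{plaquettes through e} ≤ 4 N (d-1)`;
* **ENGINE** `lintegral_oneLink_le_wilsonWeight` / `…_wilsonMeasure` — for measurable `F ≥ 0`:
  `e^{-2|β| N k} ∫ (∫_G F(h ·ₑ U) dh) dπ_β(U) ≤ ∫ F dπ_β` (`k` = #plaquettes through `e`; product
  Haar is left invariant at the link, the weight moves by at most `e^{2|β| N k}`);
* **THEOREM V** `exp_mul_haar_sqDev_le`: `e^{-2|β| N k} ∫_G (φ g - m)² dg ≤ ∫ (φ(U_p) - m)² dπ_β`
  (`(h ·ₑ U)_p = h U_p`, right invariance of Haar), whence `variance_plaquette_ge_haar`: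
  `Var_β(φ(U_p)) ≥ e^{-4N(d-1)|β|} · Var_Haar(φ)` for continuous `φ : G → ℝ`, uniformly in `L`;
* `plaqRe_variance_floor` (`G = SU(n)`, fundamental, `n ≥ 2`): `Var_β(Re tr U_p) ≥ m₂(n) e^{-4n(d-1)|β|}`,
  `m₂(n) = ∫_{SU(n)} (Re tr g)² dg` (`= 1` for `n = 2`, `½` for `n ≥ 3`, tree), so
  `plaqRe_variance_pos`: `0 < Var_β(Re tr U_p)` at EVERY `β` and every `L ≥ 2`; explicitly
  `SU(2)`: `≥ e^{-8(d-1)|β|}`, `SU(n ≥ 3)`: `≥ ½ e^{-4n(d-1)|β|}`.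

Numbers (d = 4): `SU(2)`, `β = 1.1` (`β_latt = 2.2`): floor `e^{-26.4} ≈ 3.4·10⁻¹²`; `β = 0.1`:
`e^{-2.4} ≈ 0.091`; `SU(3)`, `β = 2` (`β_latt = 6`): `½ e^{-72} ≈ 2.7·10⁻³²`. The floor is structural
(it removes the hypothesis `0 < v_p` at every coupling, uniformly in `L`), not a substitute for the
measured `v_p`. NOT CLAIMED: any lower bound on the covariances `c₁`, `c₂` at positive separation
(they vanish at `β = 0`; a bound needs the order-`β⁴` cluster expansion); sharpness; `L = 1`.
References: R. Holley, Commun. Math. Phys. 36 (1974) 227 (domination by bounded conditional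
densities); E. Seiler, LNP 159 (1982) Ch. 2; M. Lüscher, Commun. Math. Phys. 293 (2010) 899.
-/

noncomputable section

namespace Summit.Ventures.LatticeQCDFlow.TrivializingMaps

open MeasureTheory Literature.MathematicalPhysics.QuantumFieldTheory
open scoped ENNReal

namespace WitnessColumn

/-! ## §1 One link moves the action by at most `2N · #{plaquettes through it}` -/

section Action

variable {d L N : ℕ} [NeZero L] {G : Type*} [Group G] [TopologicalSpace G] [IsTopologicalGroup G]
  [CompactSpace G] (ρ : G →* Matrix (Fin N) (Fin N) ℂ)

omit [TopologicalSpace G] [IsTopologicalGroup G] [CompactSpace G] in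
/-- A plaquette not through the link `e` does not see a change of `U_e`:
`Re tr ρ((h ·ₑ U)_p) = Re tr ρ(U_p)` for `p ∉ plaqsThrough e`. -/
theorem plaqRe_mulSingle_of_not_mem [DecidableEq (Edge d L)] {e : Edge d L} {p : Plaquette d L}
    (hp : p ∉ plaqsThrough e) (h : G) (U : GaugeConfig d L G) :
    WilsonRP.plaqRe ρ (Pi.mulSingle e h * U) p = WilsonRP.plaqRe ρ U p := by
  rw [mem_plaqsThrough] at hp
  have hhol := dependsOn_plaquetteHolonomy (G := G) p (x := Pi.mulSingle e h * U) (y := U)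
    fun e' he' => by
      have hne : e' ≠ e := fun hee => hp (hee ▸ he')
      simp only [Pi.mul_apply, Pi.mulSingle_eq_of_ne hne, one_mul]
  simp only [WilsonRP.plaqRe, hhol]

omit [TopologicalSpace G] [IsTopologicalGroup G] [CompactSpace G] in
/-- Replacing the link `e` changes the action by the (signed) change of the plaquettes through
`e` only: `S(h ·ₑ U) - S(U) = ∑_{p ∋ e} (Re tr ρ(U_p) - Re tr ρ((h ·ₑ U)_p))`. -/
theorem wilsonAction_mulSingle_sub_eq [DecidableEq (Edge d L)] (e : Edge d L) (h : G)
    (U : GaugeConfig d L G) :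
    wilsonAction ρ (Pi.mulSingle e h * U) - wilsonAction ρ U
      = ∑ p ∈ plaqsThrough e,
          (WilsonRP.plaqRe ρ U p - WilsonRP.plaqRe ρ (Pi.mulSingle e h * U) p) := by
  have hred : ∑ p ∈ plaqsThrough e,
      (WilsonRP.plaqRe ρ U p - WilsonRP.plaqRe ρ (Pi.mulSingle e h * U) p)
      = ∑ p, (WilsonRP.plaqRe ρ U p - WilsonRP.plaqRe ρ (Pi.mulSingle e h * U) p) :=
    Finset.sum_subset (Finset.subset_univ _) fun p _ hp => by
      rw [plaqRe_mulSingle_of_not_mem ρ hp, sub_self]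
  rw [hred, Finset.sum_sub_distrib, WilsonRP.wilsonAction_eq, WilsonRP.wilsonAction_eq]
  ring

/-- **Replacing one link changes the Wilson action by at most `2 N · #plaqsThrough e`**
(`|Re tr ρ| ≤ N` on a compact group; only plaquettes through `e` change). -/
theorem abs_wilsonAction_mulSingle_sub_le [DecidableEq (Edge d L)] (hρ : Continuous ρ)
    (e : Edge d L) (h : G) (U : GaugeConfig d L G) :
    |wilsonAction ρ (Pi.mulSingle e h * U) - wilsonAction ρ U|
      ≤ 2 * N * ((plaqsThrough e).card : ℝ) := by
  have hterm : ∀ p ∈ plaqsThrough e,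
      |WilsonRP.plaqRe ρ U p - WilsonRP.plaqRe ρ (Pi.mulSingle e h * U) p| ≤ 2 * N := by
    intro p _
    have ha := abs_le.1 (WilsonRP.abs_plaqRe_le ρ hρ U p)
    have hb := abs_le.1 (WilsonRP.abs_plaqRe_le ρ hρ (Pi.mulSingle e h * U) p)
    exact abs_le.2 ⟨by linarith, by linarith⟩
  rw [wilsonAction_mulSingle_sub_eq ρ e h U]
  refine (Finset.abs_sum_le_sum_abs _ _).trans ((Finset.sum_le_sum hterm).trans (le_of_eq ?_))
  rw [Finset.sum_const, nsmul_eq_mul]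
  ring

end Action

/-! ## §2 ENGINE: one-link Haar resampling is dominated by the Wilson measure -/

section Engine

variable {d L N : ℕ} [NeZero L] {G : Type*} [Group G] [TopologicalSpace G] [IsTopologicalGroup G]
  [CompactSpace G] [MeasurableSpace G] [BorelSpace G] [SecondCountableTopology G]
  (ρ : G →* Matrix (Fin N) (Fin N) ℂ)

omit [CompactSpace G] in
/-- The Wilson density `U ↦ e^{-β S(U)}` (as an extended non-negative real) is measurable. -/
theorem measurable_wilsonDensity (hρ : Continuous ρ) (β : ℝ) :
    Measurable fun U : GaugeConfig d L G => ENNReal.ofReal (Real.exp (-β * wilsonAction ρ U)) :=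
  (Real.measurable_exp.comp ((measurable_wilsonAction ρ hρ).const_mul _)).ennreal_ofReal

/-- Lebesgue integrals against the Wilson weight are product-Haar integrals against the density. -/
theorem lintegral_wilsonWeight_eq (hρ : Continuous ρ) (β : ℝ) {g : GaugeConfig d L G → ℝ≥0∞}
    (hg : Measurable g) :
    ∫⁻ U, g U ∂wilsonWeight ρ β
      = ∫⁻ U, ENNReal.ofReal (Real.exp (-β * wilsonAction ρ U)) * g U
          ∂Measure.pi fun _ : Edge d L => haarProbability G := by
  rw [wilsonWeight, lintegral_withDensity_eq_lintegral_mul _ (measurable_wilsonDensity ρ hρ β) hg]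
  simp only [Pi.mul_apply]

omit [MeasurableSpace G] [BorelSpace G] [SecondCountableTopology G] in
/-- **Weight comparison.** `e^{-2|β| N k} e^{-β S(U)} ≤ e^{-β S(h ·ₑ U)}`, `k = #plaqsThrough e`. -/
theorem wilsonDensity_mulSingle_ge [DecidableEq (Edge d L)] (hρ : Continuous ρ) (β : ℝ)
    (e : Edge d L) (h : G) (U : GaugeConfig d L G) :
    ENNReal.ofReal (Real.exp (-(2 * |β| * N * ((plaqsThrough e).card : ℝ))))
        * ENNReal.ofReal (Real.exp (-β * wilsonAction ρ U))
      ≤ ENNReal.ofReal (Real.exp (-β * wilsonAction ρ (Pi.mulSingle e h * U))) := by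
  rw [← ENNReal.ofReal_mul (Real.exp_pos _).le, ← Real.exp_add]
  refine ENNReal.ofReal_le_ofReal (Real.exp_le_exp.2 ?_)
  have h1 := abs_wilsonAction_mulSingle_sub_le ρ hρ e h U
  have h2 : β * (wilsonAction ρ (Pi.mulSingle e h * U) - wilsonAction ρ U)
      ≤ |β| * (2 * N * ((plaqsThrough e).card : ℝ)) :=
    (le_abs_self _).trans (by rw [abs_mul]; exact mul_le_mul_of_nonneg_left h1 (abs_nonneg β))
  linarith

omit [CompactSpace G] in
/-- `(h, U) ↦ h ·ₑ U` (left multiplication of the link `e` by `h`) is jointly measurable. -/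
theorem measurable_mulSingle_mul [DecidableEq (Edge d L)] (e : Edge d L) :
    Measurable fun q : G × GaugeConfig d L G => Pi.mulSingle e q.1 * q.2 :=
  (((continuous_mulSingle e).comp continuous_fst).mul continuous_snd).measurable

/-- **ENGINE (un-normalised).** For every measurable `F ≥ 0` and every link `e`:
`e^{-2|β| N k} ∫ (∫_G F(h ·ₑ U) dh) dW_β(U) ≤ ∫ F dW_β`, `W_β = e^{-β S} · Haar^E`, `k = #plaqsThrough e`.
Proof: weight comparison pointwise, Tonelli, and left invariance of `Haar^E` under `U ↦ h ·ₑ U`. -/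
theorem lintegral_oneLink_le_wilsonWeight [DecidableEq (Edge d L)] (hρ : Continuous ρ) (β : ℝ)
    (e : Edge d L) {F : GaugeConfig d L G → ℝ≥0∞} (hF : Measurable F) :
    ENNReal.ofReal (Real.exp (-(2 * |β| * N * ((plaqsThrough e).card : ℝ))))
        * ∫⁻ U, (∫⁻ h, F (Pi.mulSingle e h * U) ∂haarProbability G) ∂wilsonWeight ρ β
      ≤ ∫⁻ U, F U ∂wilsonWeight ρ β := by
  have hwm := measurable_wilsonDensity (d := d) (L := L) ρ hρ β
  have hTF : Measurable fun q : G × GaugeConfig d L G => F (Pi.mulSingle e q.1 * q.2) :=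
    hF.comp (measurable_mulSingle_mul e)
  have hIm : Measurable fun U : GaugeConfig d L G =>
      ∫⁻ h, F (Pi.mulSingle e h * U) ∂haarProbability G := hTF.lintegral_prod_left'
  have hT' : Measurable fun q : GaugeConfig d L G × G => Pi.mulSingle e q.2 * q.1 :=
    (((continuous_mulSingle e).comp continuous_snd).mul continuous_fst).measurable
  have hunc : Measurable fun q : GaugeConfig d L G × G =>
      ENNReal.ofReal (Real.exp (-β * wilsonAction ρ (Pi.mulSingle e q.2 * q.1)))
        * F (Pi.mulSingle e q.2 * q.1) :=
    (hwm.comp hT').mul (hF.comp hT')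
  rw [lintegral_wilsonWeight_eq ρ hρ β hIm, lintegral_wilsonWeight_eq ρ hρ β hF]
  have hc : ENNReal.ofReal (Real.exp (-(2 * |β| * N * ((plaqsThrough e).card : ℝ)))) ≠ ∞ :=
    ENNReal.ofReal_ne_top
  rw [← lintegral_const_mul' _ _ hc]
  calc ∫⁻ U, ENNReal.ofReal (Real.exp (-(2 * |β| * N * ((plaqsThrough e).card : ℝ))))
          * (ENNReal.ofReal (Real.exp (-β * wilsonAction ρ U))
            * ∫⁻ h, F (Pi.mulSingle e h * U) ∂haarProbability G)
          ∂(Measure.pi fun _ : Edge d L => haarProbability G)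
      = ∫⁻ U, ∫⁻ h, ENNReal.ofReal (Real.exp (-(2 * |β| * N * ((plaqsThrough e).card : ℝ))))
          * ENNReal.ofReal (Real.exp (-β * wilsonAction ρ U)) * F (Pi.mulSingle e h * U)
          ∂haarProbability G ∂(Measure.pi fun _ : Edge d L => haarProbability G) :=
        lintegral_congr fun U => by
          rw [← mul_assoc, ← lintegral_const_mul' _ _ (ENNReal.mul_ne_top hc ENNReal.ofReal_ne_top)]
    _ ≤ ∫⁻ U, ∫⁻ h, ENNReal.ofReal (Real.exp (-β * wilsonAction ρ (Pi.mulSingle e h * U)))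
          * F (Pi.mulSingle e h * U)
          ∂haarProbability G ∂(Measure.pi fun _ : Edge d L => haarProbability G) := by
        refine lintegral_mono fun U => lintegral_mono fun h => ?_
        exact mul_le_mul' (wilsonDensity_mulSingle_ge ρ hρ β e h U) le_rfl
    _ = ∫⁻ h, ∫⁻ U, ENNReal.ofReal (Real.exp (-β * wilsonAction ρ (Pi.mulSingle e h * U)))
          * F (Pi.mulSingle e h * U)
          ∂(Measure.pi fun _ : Edge d L => haarProbability G) ∂haarProbability G := by
        rw [← lintegral_prod _ hunc.aemeasurable, lintegral_prod_symm _ hunc.aemeasurable]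
    _ = ∫⁻ _h, ∫⁻ U, ENNReal.ofReal (Real.exp (-β * wilsonAction ρ U)) * F U
          ∂(Measure.pi fun _ : Edge d L => haarProbability G) ∂haarProbability G :=
        lintegral_congr fun h => lintegral_mul_left_eq_self
          (μ := Measure.pi fun _ : Edge d L => haarProbability G)
          (fun U => ENNReal.ofReal (Real.exp (-β * wilsonAction ρ U)) * F U) (Pi.mulSingle e h)
    _ = ∫⁻ U, ENNReal.ofReal (Real.exp (-β * wilsonAction ρ U)) * F U
          ∂(Measure.pi fun _ : Edge d L => haarProbability G) := by
        rw [lintegral_const, measure_univ, mul_one]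

/-- **ENGINE.** The same domination for the normalised Wilson measure `π_β = Z⁻¹ W_β`:
`e^{-2|β| N k} ∫ (∫_G F(h ·ₑ U) dh) dπ_β(U) ≤ ∫ F dπ_β` for every measurable `F ≥ 0`. -/
theorem lintegral_oneLink_le_wilsonMeasure [DecidableEq (Edge d L)] (hρ : Continuous ρ) (β : ℝ)
    (e : Edge d L) {F : GaugeConfig d L G → ℝ≥0∞} (hF : Measurable F) :
    ENNReal.ofReal (Real.exp (-(2 * |β| * N * ((plaqsThrough e).card : ℝ))))
        * ∫⁻ U, (∫⁻ h, F (Pi.mulSingle e h * U) ∂haarProbability G) ∂wilsonMeasure ρ β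
      ≤ ∫⁻ U, F U ∂wilsonMeasure ρ β := by
  simp only [wilsonMeasure, lintegral_smul_measure, smul_eq_mul]
  rw [mul_left_comm]
  exact mul_le_mul' le_rfl (lintegral_oneLink_le_wilsonWeight ρ hρ β e hF)

end Engine

/-! ## §3 THEOREM V: the variance floor -/

section Floor

variable {d L N : ℕ} [NeZero L] {G : Type*} [Group G] [TopologicalSpace G] [IsTopologicalGroup G]
  [CompactSpace G] [MeasurableSpace G] [BorelSpace G] [SecondCountableTopology G]
  (ρ : G →* Matrix (Fin N) (Fin N) ℂ)

/-- A continuous real function on a compact space is bounded. -/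
theorem exists_abs_le_of_continuous {K : Type*} [TopologicalSpace K] [CompactSpace K] {ψ : K → ℝ}
    (hψ : Continuous ψ) : ∃ C, ∀ g, |ψ g| ≤ C := by
  obtain ⟨C, hC⟩ := (isCompact_range (continuous_abs.comp hψ)).isBounded.bddAbove
  exact ⟨C, fun g => hC ⟨g, rfl⟩⟩

/-- `∫ (f - m)² dμ = ∫ f² dμ - 2 m ∫ f dμ + m²` for a bounded measurable `f` on a probability space. -/
theorem integral_sub_const_sq {α : Type*} [MeasurableSpace α] (μ : Measure α)
    [IsProbabilityMeasure μ] {f : α → ℝ} (hfm : Measurable f) {C : ℝ} (hfb : ∀ x, |f x| ≤ C)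
    (m : ℝ) :
    ∫ x, (f x - m) ^ 2 ∂μ = ∫ x, f x ^ 2 ∂μ - 2 * m * ∫ x, f x ∂μ + m ^ 2 := by
  have hf : Integrable f μ := (integrable_const C).mono' hfm.aestronglyMeasurable
    (ae_of_all _ fun x => by rw [Real.norm_eq_abs]; exact hfb x)
  have hf2 : Integrable (fun x => f x ^ 2) μ :=
    (integrable_const (C ^ 2)).mono' (hfm.pow_const 2).aestronglyMeasurable
      (ae_of_all _ fun x => by
        rw [Real.norm_eq_abs, abs_pow]
        exact pow_le_pow_left₀ (abs_nonneg _) (hfb x) 2)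
  have hI : Integrable (fun x => f x ^ 2 - 2 * m * f x) μ := hf2.sub (hf.const_mul _)
  have hfun : (fun x => (f x - m) ^ 2) = fun x => (f x ^ 2 - 2 * m * f x) + m ^ 2 :=
    funext fun x => by ring
  rw [hfun, integral_add hI (integrable_const _), integral_sub hf2 (hf.const_mul _),
    integral_const_mul, integral_const, smul_eq_mul, probReal_univ, one_mul]

/-- **THEOREM V (centred form).** For every real `β`, `L ≥ 2`, plaquette `p = (x; i<j)`,
continuous `φ : G → ℝ` and every `m : ℝ`:
`e^{-2|β| N k} ∫_G (φ g - m)² dg ≤ ∫ (φ(U_p) - m)² dπ_β(U)`, `k = #plaqsThrough (x,i)`.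
(ENGINE with `F = (φ(U_p) - m)²`; `(h ·ₑ U)_p = h U_p` and right invariance of Haar.) -/
theorem exp_mul_haar_sqDev_le (hL : 2 ≤ L) (hρ : Continuous ρ) (β : ℝ) (p : Plaquette d L)
    {φ : G → ℝ} (hφ : Continuous φ) (m : ℝ) :
    Real.exp (-(2 * |β| * N * ((plaqsThrough (p.1, p.2.1.1)).card : ℝ)))
        * ∫ g, (φ g - m) ^ 2 ∂haarProbability G
      ≤ ∫ U, (φ (plaquetteHolonomy U p.1 p.2.1.1 p.2.1.2) - m) ^ 2 ∂wilsonMeasure ρ β := by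
  classical
  haveI := isProbabilityMeasure_wilsonMeasure (d := d) (L := L) ρ hρ β
  have hij : p.2.1.1 ≠ p.2.1.2 := ne_of_lt p.2.2
  set ψ : G → ℝ := fun g => (φ g - m) ^ 2 with hψ
  have hψc : Continuous ψ := (hφ.sub continuous_const).pow 2
  have hψ0 : ∀ g, 0 ≤ ψ g := fun g => sq_nonneg _
  obtain ⟨C, hC⟩ := exists_abs_le_of_continuous hψc
  have hholc : Continuous fun U : GaugeConfig d L G => plaquetteHolonomy U p.1 p.2.1.1 p.2.1.2 := by
    unfold plaquetteHolonomy; fun_prop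
  have hFm : Measurable fun U : GaugeConfig d L G =>
      ENNReal.ofReal (ψ (plaquetteHolonomy U p.1 p.2.1.1 p.2.1.2)) :=
    (hψc.comp hholc).measurable.ennreal_ofReal
  have hψi : Integrable ψ (haarProbability G) :=
    (integrable_const C).mono' hψc.measurable.aestronglyMeasurable
      (ae_of_all _ fun g => by rw [Real.norm_eq_abs]; exact hC g)
  have hψUi : Integrable (fun U : GaugeConfig d L G => ψ (plaquetteHolonomy U p.1 p.2.1.1 p.2.1.2))
      (wilsonMeasure ρ β) :=
    (integrable_const C).mono' (hψc.comp hholc).measurable.aestronglyMeasurable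
      (ae_of_all _ fun U => by rw [Real.norm_eq_abs]; exact hC _)
  have hE := lintegral_oneLink_le_wilsonMeasure ρ hρ β (p.1, p.2.1.1) hFm
  have hinner : ∀ U : GaugeConfig d L G,
      ∫⁻ h, ENNReal.ofReal (ψ (plaquetteHolonomy (Pi.mulSingle (p.1, p.2.1.1) h * U)
          p.1 p.2.1.1 p.2.1.2)) ∂haarProbability G
        = ENNReal.ofReal (∫ g, ψ g ∂haarProbability G) := fun U => by
    simp_rw [plaquetteHolonomy_mulSingle_left hL U p.1 hij]
    rw [lintegral_mul_right_eq_self (fun g => ENNReal.ofReal (ψ g))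
      (plaquetteHolonomy U p.1 p.2.1.1 p.2.1.2)]
    exact (ofReal_integral_eq_lintegral_ofReal hψi (ae_of_all _ hψ0)).symm
  simp_rw [hinner] at hE
  rw [lintegral_const, measure_univ, mul_one,
    ← ofReal_integral_eq_lintegral_ofReal hψUi (ae_of_all _ fun U => hψ0 _),
    ← ENNReal.ofReal_mul (Real.exp_pos _).le] at hE
  exact (ENNReal.ofReal_le_ofReal_iff (integral_nonneg fun U => hψ0 _)).1 hE

/-- **THEOREM V (variance floor, uniform in the volume).** For every real `β`, `L ≥ 2`, plaquette
`p` and continuous `φ : G → ℝ`: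
`e^{-4N(d-1)|β|} · Var_Haar(φ) ≤ Var_β(φ(U_p)) = ∫ φ(U_p)² dπ_β - (∫ φ(U_p) dπ_β)²`. -/
theorem variance_plaquette_ge_haar (hL : 2 ≤ L) (hρ : Continuous ρ) (β : ℝ) (p : Plaquette d L)
    {φ : G → ℝ} (hφ : Continuous φ) :
    Real.exp (-(4 * N * ((d - 1 : ℕ) : ℝ) * |β|))
        * (∫ g, φ g ^ 2 ∂haarProbability G - (∫ g, φ g ∂haarProbability G) ^ 2)
      ≤ ∫ U, φ (plaquetteHolonomy U p.1 p.2.1.1 p.2.1.2) ^ 2 ∂wilsonMeasure ρ β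
          - (∫ U, φ (plaquetteHolonomy U p.1 p.2.1.1 p.2.1.2) ∂wilsonMeasure ρ β) ^ 2 := by
  haveI := isProbabilityMeasure_wilsonMeasure (d := d) (L := L) ρ hρ β
  obtain ⟨C, hC⟩ := exists_abs_le_of_continuous hφ
  have hφU : Continuous fun U : GaugeConfig d L G => φ (plaquetteHolonomy U p.1 p.2.1.1 p.2.1.2) := by
    unfold plaquetteHolonomy; fun_prop
  have hR := integral_sub_const_sq (wilsonMeasure ρ β) hφU.measurable (fun U => hC _)
    (∫ U, φ (plaquetteHolonomy U p.1 p.2.1.1 p.2.1.2) ∂wilsonMeasure ρ β)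
  have hH := integral_sub_const_sq (haarProbability G) hφ.measurable hC
    (∫ U, φ (plaquetteHolonomy U p.1 p.2.1.1 p.2.1.2) ∂wilsonMeasure ρ β)
  have hH' := integral_sub_const_sq (haarProbability G) hφ.measurable hC
    (∫ g, φ g ∂haarProbability G)
  have h0 : 0 ≤ ∫ g, (φ g - ∫ g', φ g' ∂haarProbability G) ^ 2 ∂haarProbability G :=
    integral_nonneg fun g => sq_nonneg _
  have hVar0 : 0 ≤ ∫ g, φ g ^ 2 ∂haarProbability G - (∫ g, φ g ∂haarProbability G) ^ 2 := by
    nlinarith [hH', h0]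
  have hle : ∫ g, φ g ^ 2 ∂haarProbability G - (∫ g, φ g ∂haarProbability G) ^ 2
      ≤ ∫ g, (φ g - ∫ U, φ (plaquetteHolonomy U p.1 p.2.1.1 p.2.1.2) ∂wilsonMeasure ρ β) ^ 2
          ∂haarProbability G := by
    nlinarith [hH, sq_nonneg (∫ g, φ g ∂haarProbability G
      - ∫ U, φ (plaquetteHolonomy U p.1 p.2.1.1 p.2.1.2) ∂wilsonMeasure ρ β)]
  have hk : Real.exp (-(4 * N * ((d - 1 : ℕ) : ℝ) * |β|))
      ≤ Real.exp (-(2 * |β| * N * ((plaqsThrough (p.1, p.2.1.1)).card : ℝ))) := by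
    refine Real.exp_le_exp.2 (neg_le_neg ?_)
    have hc : ((plaqsThrough (p.1, p.2.1.1)).card : ℝ) ≤ 2 * ((d - 1 : ℕ) : ℝ) := by
      exact_mod_cast card_plaqsThrough_le (p.1, p.2.1.1)
    have h2 := mul_le_mul_of_nonneg_left hc (by positivity : (0 : ℝ) ≤ 2 * |β| * N)
    linarith
  have hV := exp_mul_haar_sqDev_le ρ hL hρ β p hφ
    (∫ U, φ (plaquetteHolonomy U p.1 p.2.1.1 p.2.1.2) ∂wilsonMeasure ρ β)
  have hmul := mul_le_mul hk hle hVar0 (Real.exp_pos _).le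
  linarith

end Floor

/-! ## §4 The plaquette witness of `SU(n)`: an explicit, strictly positive floor -/

section SUn
open Matrix
variable {d L n : ℕ} [NeZero L]

/-- **THEOREM V for lattice `SU(n)` (fundamental representation, `n ≥ 2`, any real `β`, `L ≥ 2`).**
`m₂(n) · e^{-4n(d-1)|β|} ≤ Var_β(Re tr U_p)`, `m₂(n) = ∫_{SU(n)} (Re tr g)² dg`; uniform in `L`. -/
theorem plaqRe_variance_floor (hL : 2 ≤ L) (hn : 2 ≤ n) (β : ℝ) (p : Plaquette d L) :
    (∫ g, ((g : Matrix (Fin n) (Fin n) ℂ)).trace.re ^ 2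
        ∂haarProbability (specialUnitaryGroup (Fin n) ℂ)) * Real.exp (-(4 * n * ((d - 1 : ℕ) : ℝ) * |β|))
      ≤ ∫ U, WilsonRP.plaqRe (StrongCoupling.defRep n) U p ^ 2
            ∂wilsonMeasure (StrongCoupling.defRep n) β
          - (∫ U, WilsonRP.plaqRe (StrongCoupling.defRep n) U p
              ∂wilsonMeasure (StrongCoupling.defRep n) β) ^ 2 := by
  haveI : SecondCountableTopology (Matrix (Fin n) (Fin n) ℂ) :=
    inferInstanceAs (SecondCountableTopology (Fin n → Fin n → ℂ))
  haveI : SecondCountableTopology (specialUnitaryGroup (Fin n) ℂ) :=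
    Topology.IsEmbedding.subtypeVal.secondCountableTopology
  have hφ : Continuous fun g : specialUnitaryGroup (Fin n) ℂ =>
      ((g : Matrix (Fin n) (Fin n) ℂ)).trace.re :=
    Complex.continuous_re.comp continuous_subtype_val.matrix_trace
  have h := variance_plaquette_ge_haar (StrongCoupling.defRep n) hL
    continuous_subtype_val β p hφ
  rw [integral_re_trace_haar_eq_zero hn] at h
  simp only [zero_pow two_ne_zero, sub_zero] at h
  rw [mul_comm]
  simpa only [WilsonRP.plaqRe, StrongCoupling.defRep, Submonoid.subtype_apply] using h

/-- **Strict positivity, every coupling, every volume** (`n ≥ 2`, `L ≥ 2`):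
`0 < Var_β(Re tr U_p)`.  This discharges the hypothesis `0 < v_p` of THEOREMS W/W′. -/
theorem plaqRe_variance_pos (hL : 2 ≤ L) (hn : 2 ≤ n) (β : ℝ) (p : Plaquette d L) :
    0 < ∫ U, WilsonRP.plaqRe (StrongCoupling.defRep n) U p ^ 2
            ∂wilsonMeasure (StrongCoupling.defRep n) β
          - (∫ U, WilsonRP.plaqRe (StrongCoupling.defRep n) U p
              ∂wilsonMeasure (StrongCoupling.defRep n) β) ^ 2 :=
  lt_of_lt_of_le (mul_pos (haarSqReTrace_pos (by omega)) (Real.exp_pos _))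
    (plaqRe_variance_floor hL hn β p)

/-- **`SU(2)`** (any real `β`, `L ≥ 2`): `e^{-8(d-1)|β|} ≤ Var_β(Re tr U_p)` (`m₂(2) = 1`).
At `d = 4`, `β = 1.1`: `e^{-26.4} ≈ 3.4·10⁻¹²`; at `β = 0.1`: `e^{-2.4} ≈ 0.091`. -/
theorem plaqRe_variance_floor_su2 (hL : 2 ≤ L) (β : ℝ) (p : Plaquette d L) :
    Real.exp (-(8 * ((d - 1 : ℕ) : ℝ) * |β|))
      ≤ ∫ U, WilsonRP.plaqRe (StrongCoupling.defRep 2) U p ^ 2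
            ∂wilsonMeasure (StrongCoupling.defRep 2) β
          - (∫ U, WilsonRP.plaqRe (StrongCoupling.defRep 2) U p
              ∂wilsonMeasure (StrongCoupling.defRep 2) β) ^ 2 := by
  have h := plaqRe_variance_floor (d := d) (n := 2) hL (le_refl 2) β p
  rw [haarSqReTrace_su2, one_mul] at h
  convert h using 2
  push_cast
  ring

/-- **`SU(n)`, `n ≥ 3`** (any real `β`, `L ≥ 2`): `½ e^{-4n(d-1)|β|} ≤ Var_β(Re tr U_p)`
(`m₂(n) = ½`). At `n = 3`, `d = 4`, `β = 2`: `½ e^{-72} ≈ 2.7·10⁻³²`. -/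
theorem plaqRe_variance_floor_three_le (hL : 2 ≤ L) (hn : 3 ≤ n) (β : ℝ) (p : Plaquette d L) :
    Real.exp (-(4 * n * ((d - 1 : ℕ) : ℝ) * |β|)) / 2
      ≤ ∫ U, WilsonRP.plaqRe (StrongCoupling.defRep n) U p ^ 2
            ∂wilsonMeasure (StrongCoupling.defRep n) β
          - (∫ U, WilsonRP.plaqRe (StrongCoupling.defRep n) U p
              ∂wilsonMeasure (StrongCoupling.defRep n) β) ^ 2 := by
  have h := plaqRe_variance_floor (d := d) (n := n) hL (by omega) β p
  rw [haarSqReTrace_eq_half hn] at h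
  linarith

end SUn

end WitnessColumn
end Summit.Ventures.LatticeQCDFlow.TrivializingMaps
end
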